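import Summits.HubbardSuperconductivity.HubbardSuperconductivity.Theses.DeformationLadder
import Summits.HubbardSuperconductivity.HubbardSuperconductivity.Theorems.NoGoNogoThesis
import Summits.HubbardSuperconductivity.HubbardSuperconductivity.Theorems.ThermalWedgeTwSourcedInertnessReduction
import Summits.HubbardSuperconductivity.HubbardSuperconductivity.Theorems.BalabanIRBirEveryGroundStateSchur
import Literature.MathematicalPhysics.QuantumLattice.SectorSpectrum
import Literature.MathematicalPhysics.QuantumLattice.PairChirality
import Literature.MathematicalPhysics.QuantumLattice.ApproximateEigenvectorLemmas
import Literature.MathematicalPhysics.QuantumLattice.PairFieldMomentum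

/-!
# Route `DeformationLadder`, crux `LadderThesis` (item `stmt-HubbardSuperconductivity-1890`):
# the rigidity reduction `LowEnergyRigidity → LadderThesis`, with its two finite-size supports
# discharged

`LadderThesis` (X of the route) asks, for some `U > 0`, `δ ∈ (0,1/2)`, `s > 0`, `a > 0` and all
large even `L`, for SOME normalised `(N_L, S^z = 0)`-sector ground state of the penalised pure
model `H_L + (s/L⁴)·P_L`, `H_L = hubbardTorus 2 L 1 U`, `P_L = Δ_dᴴ Δ_d`
(`Δ_d = pairField dWaveFormFactor L`), with `d`-wave LRO density `L⁻⁴ Re⟨φ, P_L φ⟩ ≥ a`.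

This support file (`--supports stmt-HubbardSuperconductivity-1890`) proves, sorry-free:

* `preservesSectors_pairPenalty`, `preservesSectors_penalised`, `isHermitian_penalised` — the
  penalised matrix `H_L + c·P_L` (`c` real) is Hermitian and block diagonal in the spin-resolved
  occupation sectors `(N↑, N↓)` (`Δ_d` has grade `(-1,-1)`, `Δ_dᴴ` grade `(1,1)`);
* `penalisedGroundStateExists_proof : PenalisedGroundStateExists` — the route's support item
  `stmt-HubbardSuperconductivity-14307`: normalised sector ground states of `H_L + c·P_L` exist in
  every sector `(2n, 0)`, `n ≤ L²` (finite-dimensional spectral theory in the invariant coordinate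
  sector, `sector_groundState`);
* `re_expect_pairPenalty_le` — the a-priori bound `Re⟨φ, P_L φ⟩ ≤ 32·L⁴` for unit `φ`
  (`‖Δ_d‖ ≤ 4√2·L²`, `norm_pairField_dWave_le`);
* `minEnergyOn_penalised_le` — the penalty raises the sector energy by at most `32 s`:
  `minEnergyOn (H_L + (s/L⁴)P_L) K ≤ minEnergyOn H_L K + 32 s` (variational principle);
* `stiffnessImpliesPenalised_proof : StiffnessImpliesPenalised` — the route's support item
  `stmt-HubbardSuperconductivity-1897`: if every unit sector vector within energy `κ` of the sector
  ground energy has LRO density `≥ a`, then for `0 < s ≤ κ/64` every normalised sector ground state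
  of `H_L + (s/L⁴)P_L` has LRO density `≥ a` (its `H_L`-energy is `≤ E₀ + 32 s ≤ E₀ + κ/2`);
* `rigidityGlue_proof : RigidityGlue` — the route's glue item `stmt-HubbardSuperconductivity-14525`
  (pure logic, `s := κ/64`);
* `ladderThesis_of_lowEnergyRigidity : LowEnergyRigidity → LadderThesis` — the crux reduced, by
  name and unconditionally, to the rank-2 corner crux `LowEnergyRigidity`
  (`stmt-HubbardSuperconductivity-1892`) of the same route.

Sources: T. A. Kaplan, P. Horsch, W. von der Linden, J. Phys. Soc. Jpn. 58 (1989) 3894 (the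
variational comparison); E. H. Lieb, PRL 62 (1989) 1201 (sector ground states); D. J. Scalapino,
Phys. Rep. 250 (1995) 329, §2 (pair field); H. Tasaki, *Physics and Mathematics of Quantum
Many-Body Systems* (2020) §2.1–2.2 (variational principle). All finite-dimensional linear algebra.
-/

set_option linter.dupNamespace false

noncomputable section

namespace Summit.HubbardSuperconductivity.HubbardSuperconductivity.Theorems.DeformationLadder

open Matrix Literature.MathematicalPhysics.QuantumLattice Literature.Probability.LatticeModels
open Summit.HubbardSuperconductivity.HubbardSuperconductivity.Theses.DeformationLadder
open scoped Matrix.Norms.L2Operator ComplexOrder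

/-! ### The penalised Hamiltonian: hermiticity and sector structure -/

section Penalised

variable (L : ℕ) [NeZero L]

/-- `Δ_dᴴ Δ_d` conserves `N↑` and `N↓` (`Δ_d` has `(N↑, N↓)`-grade `(-1,-1)`, its adjoint grade
`(1,1)`). Tasaki (2020) §9.3. [folklore] -/
theorem preservesSectors_pairPenalty :
    PreservesSectors ((pairField dWaveFormFactor L)ᴴ * pairField dWaveFormFactor L) := by
  have hP : PairChirality.Shifts (-1) (-1) (pairField dWaveFormFactor L) :=
    PairChirality.Shifts.sum fun x _ => PairChirality.shifts_localPair L dWaveFormFactor x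
  have h := hP.conjTranspose.mul hP
  simp only [Int.reduceNeg, neg_neg, add_neg_cancel] at h
  exact h.preservesSectors

/-- The penalised Hamiltonian `H_L + c·Δ_dᴴΔ_d` conserves `N↑` and `N↓`, for every complex `c`.
Lieb, PRL 62 (1989) 1201, Remark (2). [folklore] -/
theorem preservesSectors_penalised (U : ℝ) (c : ℂ) :
    PreservesSectors (hubbardTorus 2 L 1 U +
      c • ((pairField dWaveFormFactor L)ᴴ * pairField dWaveFormFactor L)) :=
  (LiebThm1.preservesSectors_hamiltonian (fermionTorusGraph 2 L) 1 U).add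
    ((preservesSectors_pairPenalty L).smul c)

/-- The penalised Hamiltonian `H_L + c·Δ_dᴴΔ_d` is Hermitian for real `c`. [folklore] -/
theorem isHermitian_penalised (U c : ℝ) :
    (hubbardTorus 2 L 1 U +
      ((c : ℝ) : ℂ) • ((pairField dWaveFormFactor L)ᴴ * pairField dWaveFormFactor L)).IsHermitian := by
  have h := isHermitian_hubbardTorusWith L 1 U 0
  rw [hubbardTorusWith_zero] at h
  exact h.add ((pairField_conjTranspose_mul_self_posSemidef dWaveFormFactor L).isHermitian.smul
    (by rw [isSelfAdjoint_iff, Complex.star_def, Complex.conj_ofReal]))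

/-- **Sector ground states of the penalised Hamiltonian exist** (with the variational bound): for
`n ≤ L²` the matrix `H_L + c·Δ_dᴴΔ_d` (`c` real) has a ground state in the joint sector
`(N, S^z) = (2n, 0)`, and its sector energy bounds the Rayleigh quotient of every unit vector of the
sector from below. Lieb, PRL 62 (1989) 1201, proof of Thm 1; Tasaki (2020) §2.2. [folklore] -/
theorem penalised_sector_groundState (U c : ℝ) {n : ℕ} (hn : n ≤ L ^ 2) :
    (∃ ψ, IsGroundStateInSector (hubbardTorus 2 L 1 U +
        ((c : ℝ) : ℂ) • ((pairField dWaveFormFactor L)ᴴ * pairField dWaveFormFactor L)) (2 * n) 0 ψ) ∧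
      ∀ v ∈ szSector (Λ := FermionTorus 2 L) (2 * n) 0, star v ⬝ᵥ v = 1 →
        (hubbardTorus 2 L 1 U +
            ((c : ℝ) : ℂ) • ((pairField dWaveFormFactor L)ᴴ * pairField dWaveFormFactor L)).minEnergyOn
            (szSector (2 * n) 0) ≤
          (star v ⬝ᵥ (hubbardTorus 2 L 1 U +
            ((c : ℝ) : ℂ) • ((pairField dWaveFormFactor L)ᴴ * pairField dWaveFormFactor L)) *ᵥ v).re := by
  classical
  set A := hubbardTorus 2 L 1 U +
    ((c : ℝ) : ℂ) • ((pairField dWaveFormFactor L)ᴴ * pairField dWaveFormFactor L) with hA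
  have hcard : n ≤ Fintype.card (FermionTorus 2 L) := by
    rwa [Summit.HubbardSuperconductivity.NoGo.card_fermionTorus_two]
  obtain ⟨α₀, -, hα₀⟩ : ∃ α₀ : Finset (FermionTorus 2 L), α₀ ⊆ Finset.univ ∧ α₀.card = n :=
    Finset.exists_subset_card_eq (by rwa [Finset.card_univ])
  have hp : ∃ s : Finset (Orb (FermionTorus 2 L)), (upPart s).card = n ∧ (downPart s).card = n :=
    ⟨pairSet α₀ α₀, by rw [upPart_pairSet, hα₀], by rw [downPart_pairSet, hα₀]⟩
  have hPS := preservesSectors_penalised L U ((c : ℝ) : ℂ)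
  have hinv : ∀ s s' : Finset (Orb (FermionTorus 2 L)),
      ¬((upPart s).card = n ∧ (downPart s).card = n) →
      ((upPart s').card = n ∧ (downPart s').card = n) → A s s' = 0 := by
    intro s s' hs hs'
    by_contra h
    have := hPS s s' h
    exact hs ⟨this.1.trans hs'.1, this.2.trans hs'.2⟩
  have hK : ∀ v : Fock (Orb (FermionTorus 2 L)), v ∈ szSector (2 * n) (0 : ℝ) ↔
      ∀ s, ¬((upPart s).card = n ∧ (downPart s).card = n) → v s = 0 :=
    fun v => mem_szSector_two_mul_zero_iff n v
  obtain ⟨⟨v, hv, hv0, hAv⟩, hb⟩ := sector_groundState A (isHermitian_penalised L U c)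
    (fun s => (upPart s).card = n ∧ (downPart s).card = n) hp hinv (szSector (2 * n) 0) hK
  exact ⟨⟨v, hv, hv0, hAv⟩, hb⟩

/-- **`PenalisedGroundStateExists` holds** (route `DeformationLadder`, support item
`stmt-HubbardSuperconductivity-14307`): for every side `L ≥ 1`, coupling `U`, real coefficient `c`
and `n ≤ L²` the penalised matrix `hubbardTorus 2 L 1 U + c·(Δ_dᴴΔ_d)` has a unit-norm ground state
in the joint sector `(N, S^z) = (2n, 0)`. Lieb, PRL 62 (1989) 1201, proof of Thm 1;
Tasaki (2020) §2.2. [folklore] -/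
theorem penalisedGroundStateExists_proof : PenalisedGroundStateExists := by
  intro L _ U c n hn
  obtain ⟨⟨ψ, hψ⟩, -⟩ := penalised_sector_groundState L U c hn
  obtain ⟨a, ha, ha1⟩ := exists_smul_unit hψ.2.1
  exact ⟨a • ψ, ha1, Summit.HubbardSuperconductivity.NoGo.isGroundStateInSector_smul _ _ _ hψ ha⟩

/-! ### A priori bound on the pair penalty and the variational sandwich -/

/-- `Re⟨φ, Δ_dᴴΔ_d φ⟩ = ‖Δ_d φ‖² ≥ 0`. [folklore] -/
theorem re_expect_pairPenalty_nonneg (φ : Fock (Orb (FermionTorus 2 L))) :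
    0 ≤ (expect ((pairField dWaveFormFactor L)ᴴ * pairField dWaveFormFactor L) φ).re := by
  rw [expect, ← star_mulVec_dotProduct_mulVec]
  exact (Complex.nonneg_iff.1 (dotProduct_star_self_nonneg _)).1

/-- **A priori bound** `Re⟨φ, Δ_dᴴΔ_d φ⟩ ≤ 32·L⁴` for a unit vector `φ`
(`Re⟨φ, Δ_dᴴΔ_d φ⟩ = ‖Δ_d φ‖² ≤ ‖Δ_d‖²` and `‖Δ_d‖ ≤ 4√2·L²`). [cite: Scalapino1995, §2] -/
theorem re_expect_pairPenalty_le {φ : Fock (Orb (FermionTorus 2 L))} (hφ : star φ ⬝ᵥ φ = 1) :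
    (expect ((pairField dWaveFormFactor L)ᴴ * pairField dWaveFormFactor L) φ).re ≤
      32 * (L : ℝ) ^ 4 := by
  rw [expect, ← star_mulVec_dotProduct_mulVec, ← eucNorm_sq]
  have h1 : eucNorm (pairField dWaveFormFactor L *ᵥ φ) ≤ 4 * Real.sqrt 2 * (L : ℝ) ^ 2 := by
    have h := eucNorm_mulVec_le (pairField dWaveFormFactor L) φ
    rw [eucNorm_eq_one hφ, mul_one] at h
    exact h.trans (norm_pairField_dWave_le L)
  have h0 : 0 ≤ eucNorm (pairField dWaveFormFactor L *ᵥ φ) := eucNorm_nonneg _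
  have hsq : Real.sqrt 2 ^ 2 = 2 := Real.sq_sqrt zero_le_two
  calc eucNorm (pairField dWaveFormFactor L *ᵥ φ) ^ 2
      ≤ (4 * Real.sqrt 2 * (L : ℝ) ^ 2) ^ 2 := pow_le_pow_left₀ h0 h1 2
    _ = 32 * (L : ℝ) ^ 4 := by rw [mul_pow, mul_pow, hsq]; ring

/-- **The penalty raises the sector energy by at most `32 s`**: for `s ≥ 0` and a sector `K`
containing a unit vector, `minEnergyOn (H_L + (s/L⁴)Δ_dᴴΔ_d) K ≤ minEnergyOn H_L K + 32 s`
(every unit trial vector of `K` for `H_L` is a trial vector for the penalised matrix, and the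
penalty term contributes `≤ (s/L⁴)·32L⁴`). Kaplan–Horsch–von der Linden (1989); Tasaki (2020)
§2.1. [cite: KaplanHorschVonDerLinden1989] -/
theorem minEnergyOn_penalised_le (U : ℝ) {s : ℝ} (hs : 0 ≤ s)
    (K : Submodule ℂ (Fock (Orb (FermionTorus 2 L))))
    (hK : ∃ ψ ∈ K, star ψ ⬝ᵥ ψ = 1) :
    (hubbardTorus 2 L 1 U + ((s / (L : ℝ) ^ 4 : ℝ) : ℂ) •
        ((pairField dWaveFormFactor L)ᴴ * pairField dWaveFormFactor L)).minEnergyOn K ≤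
      (hubbardTorus 2 L 1 U).minEnergyOn K + 32 * s := by
  have hL : (0 : ℝ) < (L : ℝ) ^ 4 := by
    have : (0 : ℝ) < L := by exact_mod_cast Nat.pos_of_ne_zero (NeZero.ne L)
    positivity
  obtain ⟨ψ₀, hψ₀K, hψ₀⟩ := hK
  rw [← sub_le_iff_le_add]
  refine le_csInf ⟨_, ψ₀, hψ₀K, hψ₀, rfl⟩ ?_
  rintro E ⟨ψ, hψK, hψ, rfl⟩
  have h1 := minEnergyOn_le_re_rayleigh (hubbardTorus 2 L 1 U + ((s / (L : ℝ) ^ 4 : ℝ) : ℂ) •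
    ((pairField dWaveFormFactor L)ᴴ * pairField dWaveFormFactor L)) K hψK hψ
  rw [add_mulVec, dotProduct_add, Complex.add_re, smul_mulVec, dotProduct_smul,
    smul_eq_mul, Complex.re_ofReal_mul] at h1
  have h2 := re_expect_pairPenalty_le L hψ
  rw [expect] at h2
  have h3 : s / (L : ℝ) ^ 4 *
      (star ψ ⬝ᵥ ((pairField dWaveFormFactor L)ᴴ * pairField dWaveFormFactor L) *ᵥ ψ).re ≤
      32 * s := by
    calc s / (L : ℝ) ^ 4 *
        (star ψ ⬝ᵥ ((pairField dWaveFormFactor L)ᴴ * pairField dWaveFormFactor L) *ᵥ ψ).re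
        ≤ s / (L : ℝ) ^ 4 * (32 * (L : ℝ) ^ 4) :=
          mul_le_mul_of_nonneg_left h2 (div_nonneg hs hL.le)
      _ = 32 * (s / (L : ℝ) ^ 4 * (L : ℝ) ^ 4) := by ring
      _ = 32 * s := by rw [div_mul_cancel₀ s hL.ne']
  linarith

end Penalised

/-! ### `StiffnessImpliesPenalised`, `RigidityGlue`, and the reduction of the crux -/

/-- **`StiffnessImpliesPenalised` holds** (route `DeformationLadder`, support item
`stmt-HubbardSuperconductivity-1897`). If every unit `φ ∈ szSector N 0` with
`Re⟨φ, H_L φ⟩ ≤ minEnergyOn H_L (szSector N 0) + κ` has LRO density `≥ a`, then for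
`0 < s ≤ κ/64` every normalised sector ground state `φ` of `H_L + (s/L⁴)Δ_dᴴΔ_d` has LRO density
`≥ a`: with `E_s` the penalised sector energy, `Re⟨φ, H_L φ⟩ = E_s − (s/L⁴)Re⟨φ, Δ_dᴴΔ_d φ⟩ ≤ E_s
≤ E₀ + 32 s ≤ E₀ + κ/2`. Kaplan–Horsch–von der Linden, J. Phys. Soc. Jpn. 58 (1989) 3894;
Scalapino, Phys. Rep. 250 (1995) 329, §2. [cite: KaplanHorschVonDerLinden1989] -/
theorem stiffnessImpliesPenalised_proof : StiffnessImpliesPenalised := by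
  intro L _ U κ a N hκ hrig s hs φ hφ hgs
  obtain ⟨hmem, -, heig⟩ := hgs
  have hL : (0 : ℝ) < (L : ℝ) ^ 4 := by
    have : (0 : ℝ) < L := by exact_mod_cast Nat.pos_of_ne_zero (NeZero.ne L)
    positivity
  refine hrig φ hmem hφ ?_
  -- the penalised energy of `φ` is the penalised sector energy
  set P := (pairField dWaveFormFactor L)ᴴ * pairField dWaveFormFactor L with hP
  set Es := (hubbardTorus 2 L 1 U + ((s / (L : ℝ) ^ 4 : ℝ) : ℂ) • P).minEnergyOn
    (szSector N 0) with hEs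
  have h1 : (star φ ⬝ᵥ (hubbardTorus 2 L 1 U + ((s / (L : ℝ) ^ 4 : ℝ) : ℂ) • P) *ᵥ φ).re = Es := by
    rw [heig, dotProduct_smul, hφ, smul_eq_mul, mul_one, Complex.ofReal_re]
  rw [add_mulVec, dotProduct_add, Complex.add_re, smul_mulVec, dotProduct_smul,
    smul_eq_mul, Complex.re_ofReal_mul] at h1
  -- the penalised sector energy is at most `E₀ + 32 s`
  have h2 := minEnergyOn_penalised_le L U hs.1.le (szSector N 0) ⟨φ, hmem, hφ⟩
  have h3 : 0 ≤ s / (L : ℝ) ^ 4 * (star φ ⬝ᵥ P *ᵥ φ).re :=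
    mul_nonneg (div_nonneg hs.1.le hL.le) (re_expect_pairPenalty_nonneg L φ)
  have h4 : 32 * s ≤ κ := by linarith [hs.2]
  linarith

/-- **`RigidityGlue` holds** (route `DeformationLadder`, glue item
`stmt-HubbardSuperconductivity-14525`): `LowEnergyRigidity → StiffnessImpliesPenalised →
PenalisedGroundStateExists → LadderThesis`, by `s := κ/64`, `c := (κ/64)/L⁴`,
`n := ⌊(1-δ)L²/2⌋ ≤ L²`. Kaplan–Horsch–von der Linden (1989); Scalapino (1995) §2.
[cite: KaplanHorschVonDerLinden1989] -/
theorem rigidityGlue_proof : RigidityGlue := by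
  intro hR hS hE
  obtain ⟨U, hU, δ, hδ, κ, hκ, a, ha, L₀, h⟩ := hR
  refine ⟨U, hU, δ, hδ, κ / 64, by positivity, a, ha, L₀, fun L _ hL hev => ?_⟩
  obtain ⟨φ, hφ1, hφ⟩ := hE L U (κ / 64 / (L : ℝ) ^ 4) ⌊(1 - δ) * (L : ℝ) ^ 2 / 2⌋₊
    (Summit.HubbardSuperconductivity.NoGo.floor_pairNumber_le δ (by linarith [hδ.1]) L)
  exact ⟨φ, hφ1, hφ, hS L U κ a _ hκ (h L hL hev) (κ / 64) ⟨by positivity, le_rfl⟩ φ hφ1 hφ⟩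

/-- **The crux reduced to the corner crux.** `LowEnergyRigidity → LadderThesis`: O(1)-scale phase
rigidity of the pure model (every unit sector vector within energy `κ` of the sector ground energy
has `d`-wave LRO density `≥ a`, route item `stmt-HubbardSuperconductivity-1892`) implies the
target X of route `DeformationLadder` with `s = κ/64` — unconditionally, the two finite-size
supports being `stiffnessImpliesPenalised_proof` and `penalisedGroundStateExists_proof`.
Kaplan–Horsch–von der Linden, J. Phys. Soc. Jpn. 58 (1989) 3894. [cite: KaplanHorschVonDerLinden1989] -/
theorem ladderThesis_of_lowEnergyRigidity (h : LowEnergyRigidity) : LadderThesis :=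
  rigidityGlue_proof h stiffnessImpliesPenalised_proof penalisedGroundStateExists_proof

end Summit.HubbardSuperconductivity.HubbardSuperconductivity.Theorems.DeformationLadder
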